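import Literature.Computability.Complexity.PEASigmaTwo

/-!
# PneNP / SzkEntropy — support item `PeaMemPH` (stmt-PneNP-10779): `PEA_d ∈ promise-PH`

Route `PneNP/SzkEntropy`, item stmt-PneNP-10779 (`PeaMemPH`, support, rank 2): for every degree
bound `d`, the promise problem `PEA_d` (entropy approximation for sparse polynomial maps over `F₂`,
gap one bit at an integer threshold) is separated by a language of the polynomial hierarchy.  This is
the one `PEA` fact the route's deciding theorem `closes` consumes besides the thesis X.

PROVED via the Literature series `PEASigmaTwo*.lean` (this session): in fact
`PEA d ∈ promiseLift (SigmaP 2)` (`PEAHash.PEA_mem_promiseLift_SigmaP_two`), by a direct,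
deterministic rendering of the approximate-counting upper bound with Sipser's Coding Lemma — sample
`T = 128 n'²` points, cap the product fibre with one affine hash, and ask whether the `t`-fold power
of the resulting `NP`-set is separable by `t(M-1)` linear hash matrices; the matrix of that `Σ₂ᵖ`
predicate is the polynomial-time program `PEAHash.matP` (certified in the tree's `CodeFP` algebra),
the variables being first renamed because `n` is written in binary.

The theorem is stated STRUCTURALLY (the body of the route decl `PeaMemPH`, which is definitionally
`∀ d, Literature.Computability.Complexity.PEA d ∈ promiseLift PH`) and this file deliberately does
NOT import the route file `Summits.PneNP.PneNP.Theses.SzkEntropy`, so that the gate can link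
`PeaMemPH_holds` by importing this module into the route file without an import cycle (cf. the
rev-3 notes on items 13908–13910).

References: M. Sipser, STOC 1983, §III/§V; L. Stockmeyer, SIAM J. Comput. 14 (1985);
O. Goldreich, A. Sahai, S. Vadhan, CRYPTO 1999 (`EA ∈ NISZK ⊆ AM ∩ coAM`); Z. Dvir, D. Gutfreund,
G. N. Rothblum, S. Vadhan, ECCC TR10-160 / ICS 2011, §3.
-/

namespace Summit.PneNP.PneNP.Theorems

/-- **`PeaMemPH` holds** (route `SzkEntropy`, item stmt-PneNP-10779): for every `d`, `PEA_d` —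
spelled inline exactly as in the route file (`let ev/H/PEA := …; ∀ d, PEA d ∈ promiseLift PH`) — lies
in `promiseLift PH`; by `Literature.Computability.Complexity.PEAHash.PEA_mem_promiseLift_PH`
(indeed in `promiseLift (SigmaP 2)`). [DvirGutfreundRothblumVadhan2010, §3; Sipser1983, §V;
GoldreichSahaiVadhan1999] -/
theorem peaMemPH_proof :
    (let ev : (n : ℕ) → List (List (List (Fin n))) → (Fin n → ZMod 2) → List (ZMod 2) := fun _ P x => P.map fun p => (p.map fun μ => (μ.map x).prod).sum; let H : (Σ n : ℕ, List (List (List (Fin n))) × ℕ) → ℝ := fun I => (∑ x : Fin I.1 → ZMod 2, Real.logb 2 (((Finset.univ : Finset (Fin I.1 → ZMod 2)).card : ℝ) / (Finset.univ.filter fun x' : Fin I.1 → ZMod 2 => ev I.1 I.2.1 x' = ev I.1 I.2.1 x).card)) / (Finset.univ : Finset (Fin I.1 → ZMod 2)).card; let PEA : ℕ → Literature.Computability.Complexity.PromiseProblem := fun d => Literature.Computability.Complexity.PromiseProblem.ofEncoding (Computability.Encoding.sigmaBool fun n => ((Literature.Computability.Complexity.encodingFinBool n).listBool.listBool.listBool).pairBool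 Computability.encodingNatBool) {I : (Σ n : ℕ, List (List (List (Fin n))) × ℕ) | (∀ p ∈ I.2.1, ∀ μ ∈ p, μ.length ≤ d) ∧ (I.2.2 : ℝ) + 1 ≤ H I} {I : (Σ n : ℕ, List (List (List (Fin n))) × ℕ) | (∀ p ∈ I.2.1, ∀ μ ∈ p, μ.length ≤ d) ∧ H I ≤ (I.2.2 : ℝ)}; ∀ d : ℕ, PEA d ∈ Literature.Computability.Complexity.promiseLift Literature.Computability.Complexity.PH) :=
  fun d => Literature.Computability.Complexity.PEAHash.PEA_mem_promiseLift_PH d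

end Summit.PneNP.PneNP.Theorems
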